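import Literature.NumberTheory.LFunctions.KMVCutoffWSmooth
import Mathlib.Analysis.Calculus.IteratedDeriv.Lemmas
import Mathlib.Analysis.SpecialFunctions.ImproperIntegrals
import HarnessLib

/-!
# Route `PrimeLevelFamEdge`, crux K_B (stmt-Parity-20343), line `diagonal_kernel_split` rev 4, plan Ω,
# lemma L2c (derivative costs), primitive 2: **all derivatives of KMV's cut-off `W`: `|tʲ (dʲ/dtʲ) W(at)| ≤ j!`**

OMEGA-BLUEPRINT §2–§3 L2: in the box weight `Φ_i` the factor `W((d₁y₁)(d₂y₂)/q̂²)` (`W = KMV2000.cutoffW`,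
`W(y) = ∫₀^∞ e^{−u−y/u} du`) is differentiated `k` times. From the tree's `KMVCutoffWSmooth`
(`W_n(y) = ∫₀^∞ u^{−n}e^{−u−y/u}du`, `W_n' = −W_{n+1}`, dominated integrand `u^{−n}e^{−u−y/u} ≤ n!·y^{−n}·e^{−u}`):

* `cutoffWFamily_le_factorial_mul` — `W_n(y) ≤ n!·y^{−n}` (`y > 0`), i.e. `yⁿ W_n(y) ≤ n!`;
* `iteratedDeriv_cutoffW_comp_mul` — for `a > 0`, on `t > 0`: `(dʲ/dtʲ) W(at) = (−a)ʲ W_j(at)`;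
* **`abs_pow_mul_iteratedDeriv_cutoffW_comp_mul_le`** — `|tʲ · (dʲ/dtʲ) W(at)| ≤ j!` for `a, t > 0`:
  each `t`-derivative of the `W`-factor costs `1/t` (`≤ 2/K_j` on a dyadic box), INDEPENDENTLY of the scale
  `X = a·t` (better than BLUEPRINT §2's `(1+X)/K_j`).

Folklore real analysis, PROVED; theorems only. Helper; closes nothing.
«The programme SEARCHES and TYPES; no claim about Landau–Siegel zeros, Theorems 1–2 of arXiv:2211.02515 or
a repaired Margin232 until a kernel theorem says so.»
-/

noncomputable section

open Real MeasureTheory Set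
open scoped Topology ContDiff Nat

namespace Summit.Parity.GeneralizedHardyLittlewood.Theorems.BeyondDiagonalBeatsQuarter.OffDiagPoissonTwisted

open Literature.NumberTheory.LFunctions.KMV2000

/-- `W_n(y) ≥ 0`. [folklore] -/
theorem cutoffWFamily_nonneg (n : ℕ) (y : ℝ) :
    0 ≤ ∫ u in Ioi (0 : ℝ), (u ^ n)⁻¹ * Real.exp (-u - y / u) :=
  setIntegral_nonneg measurableSet_Ioi fun u hu => by
    have : 0 < u := mem_Ioi.mp hu
    positivity

/-- **`W_n(y) ≤ n!·y^{−n}`** for `y > 0` (the dominated integrand `u^{−n}e^{−u−y/u} ≤ n! y^{−n} e^{−u}` of the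
tree's `norm_inv_pow_mul_exp_le`, integrated). [cite: KowalskiMichelVanderKam2000, (21)–(22) p. 12 — derivation] -/
theorem cutoffWFamily_le_factorial_mul (n : ℕ) {y : ℝ} (hy : 0 < y) :
    (∫ u in Ioi (0 : ℝ), (u ^ n)⁻¹ * Real.exp (-u - y / u)) ≤ (n ! : ℝ) * (y ^ n)⁻¹ := by
  calc (∫ u in Ioi (0 : ℝ), (u ^ n)⁻¹ * Real.exp (-u - y / u))
      ≤ ∫ u in Ioi (0 : ℝ), (n ! : ℝ) * (y ^ n)⁻¹ * Real.exp (-u) := by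
        refine setIntegral_mono_on (integrableOn_inv_pow_mul_exp n hy)
          ((_root_.integrableOn_exp_neg_Ioi 0).const_mul _) measurableSet_Ioi fun u hu => ?_
        have h := norm_inv_pow_mul_exp_le hy le_rfl (mem_Ioi.mp hu) n
        rwa [Real.norm_of_nonneg (by have : 0 < u := mem_Ioi.mp hu; positivity)] at h
    _ = (n ! : ℝ) * (y ^ n)⁻¹ * ∫ u in Ioi (0 : ℝ), Real.exp (-u) := integral_const_mul _ _
    _ = (n ! : ℝ) * (y ^ n)⁻¹ := by rw [integral_exp_neg_Ioi_zero, mul_one]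

/-- `yⁿ · W_n(y) ≤ n!` for `y > 0`. [folklore] -/
theorem pow_mul_cutoffWFamily_le (n : ℕ) {y : ℝ} (hy : 0 < y) :
    y ^ n * ∫ u in Ioi (0 : ℝ), (u ^ n)⁻¹ * Real.exp (-u - y / u) ≤ n ! := by
  have h := mul_le_mul_of_nonneg_left (cutoffWFamily_le_factorial_mul n hy) (pow_nonneg hy.le n)
  rwa [← mul_assoc, mul_comm (y ^ n) (n ! : ℝ), mul_assoc, mul_inv_cancel₀ (pow_ne_zero n hy.ne'),
    mul_one] at h

/-- **The derivatives of `t ↦ W(at)` on `t > 0`**: `(dʲ/dtʲ) W(at) = (−a)ʲ · W_j(at)` for `a > 0`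
(induction on `j` through the tree's `W_n' = −W_{n+1}`; locality of `deriv`). [folklore] -/
theorem iteratedDeriv_cutoffW_comp_mul {a : ℝ} (ha : 0 < a) (j : ℕ) :
    EqOn (iteratedDeriv j (fun t : ℝ => cutoffW (a * t)))
      (fun t : ℝ => (-a) ^ j * ∫ u in Ioi (0 : ℝ), (u ^ j)⁻¹ * Real.exp (-u - a * t / u)) (Ioi 0) := by
  induction j with
  | zero =>
    intro t _
    simp [cutoffW]
  | succ j ih =>
    intro t ht
    have ht' : 0 < t := mem_Ioi.mp ht
    rw [iteratedDeriv_succ]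
    -- `iteratedDeriv j` agrees with the closed form near `t`, so the derivatives agree
    have hev : iteratedDeriv j (fun t : ℝ => cutoffW (a * t)) =ᶠ[𝓝 t]
        fun t : ℝ => (-a) ^ j * ∫ u in Ioi (0 : ℝ), (u ^ j)⁻¹ * Real.exp (-u - a * t / u) :=
      ih.eventuallyEq_of_mem (Ioi_mem_nhds ht')
    rw [hev.deriv_eq]
    -- derivative of the closed form: chain rule with `W_j' = −W_{j+1}` at `a t`
    have hW := hasDerivAt_cutoffWFamily j (mul_pos ha ht')
    have hcomp : HasDerivAt (fun s : ℝ => ∫ u in Ioi (0 : ℝ), (u ^ j)⁻¹ * Real.exp (-u - a * s / u))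
        (-(∫ u in Ioi (0 : ℝ), (u ^ (j + 1))⁻¹ * Real.exp (-u - a * t / u)) * a) t := by
      have h := hW.comp t ((hasDerivAt_id t).const_mul a)
      simpa [Function.comp_def, mul_one] using h
    rw [((hcomp.const_mul ((-a) ^ j))).deriv, pow_succ]
    ring

/-- **`|tʲ · (dʲ/dtʲ) W(at)| ≤ j!`** for `a, t > 0` — a `t`-derivative of the `W`-factor costs `1/t`, uniformly
in the scale `a·t`. [folklore] -/
theorem abs_pow_mul_iteratedDeriv_cutoffW_comp_mul_le {a : ℝ} (ha : 0 < a) (j : ℕ) {t : ℝ} (ht : 0 < t) :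
    |t ^ j * iteratedDeriv j (fun t : ℝ => cutoffW (a * t)) t| ≤ j ! := by
  rw [iteratedDeriv_cutoffW_comp_mul ha j (mem_Ioi.mpr ht)]
  have hat : 0 < a * t := mul_pos ha ht
  have hW0 := cutoffWFamily_nonneg j (a * t)
  have hkey := pow_mul_cutoffWFamily_le j hat
  rw [show t ^ j * ((-a) ^ j * ∫ u in Ioi (0 : ℝ), (u ^ j)⁻¹ * Real.exp (-u - a * t / u)) =
      (-1) ^ j * ((a * t) ^ j * ∫ u in Ioi (0 : ℝ), (u ^ j)⁻¹ * Real.exp (-u - a * t / u)) by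
    rw [mul_pow, neg_eq_neg_one_mul, mul_pow]; ring]
  rw [abs_mul, abs_pow, abs_neg, abs_one, one_pow, one_mul,
    abs_of_nonneg (mul_nonneg (pow_nonneg hat.le j) hW0)]
  exact hkey

/-- The unscaled case `a = 1`: `|yʲ W^{(j)}(y)| ≤ j!` for `y > 0`. [folklore] -/
theorem abs_pow_mul_iteratedDeriv_cutoffW_le (j : ℕ) {y : ℝ} (hy : 0 < y) :
    |y ^ j * iteratedDeriv j cutoffW y| ≤ j ! := by
  have h := abs_pow_mul_iteratedDeriv_cutoffW_comp_mul_le one_pos j hy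
  simpa only [one_mul] using h

end Summit.Parity.GeneralizedHardyLittlewood.Theorems.BeyondDiagonalBeatsQuarter.OffDiagPoissonTwisted
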